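import Mathlib.Analysis.Convex.Topology
import Literature.Probability.LatticeModels.CellDomain
import HarnessLib

/-!
# Cell domains: side midpoints of boundary edges lie on the frontier

Topic `Literature/Probability/LatticeModels`; companion to `CellDomain.lean` (definition item
`defn-CellDomain`, route SAWSchrammPassage of `Summits/CriticalPhenomena/SAWScalingLimit`). The
route marks its Dobrushin cell domains at the side midpoints `a = (δp + δp')/2` of a site `p ∈ S`
and an adjacent exterior site `p' ∉ S` (`D.pt 0 = (meshPoint δ p + meshPoint δ p') / 2` in items
`stmt-CriticalPhenomena-5595/5596`); a marked point of a Jordan domain must lie on the frontier of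
the carrier, which is what `midpoint_mem_frontier_cellDomain` provides for `CellDomain S δ`.

## Contents (namespace `Literature.Probability.LatticeModels`)

* `meshPoint_sub_meshPoint_of_adj`, `abs_re_im_meshPoint_sub_of_adj` — the displacement
  `δp' − δp` of adjacent sites is `±δ` or `±δi`.
* `eq_of_mem_cutCell_of_abs_sub_lt` — a point of `cutCell δ v` at sup-distance `< δ/2` from the
  mesh point `δu` forces `u = v` (`δ > 0`).
* `midpoint_mem_frontier_cellDomain` — **for `δ > 0`, `p ∈ S`, `p' ∉ S` adjacent, the side
  midpoint `(δp + δp')/2` lies on `frontier (CellDomain S δ)`**: the open segment from `δp` to it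
  lies in the domain (convexity of the cell), while points just beyond it towards `δp'` could only
  belong to the cell of `p' ∉ S`.

## References

* D. Chelkak, S. Smirnov, Invent. Math. 189 (2012), §4 (polygonal domains, boundary
  half-edges); S. Smirnov, C. R. Acad. Sci. Paris 333 (2001), §2.

Mathlib anchors: `frontier`, `IsOpen.interior_eq`, `segment_subset_closure_openSegment`,
`Convex.openSegment_interior_self_subset_interior`, `Complex.re_ofReal_mul`, `Complex.norm_real`.
-/

noncomputable section

open Set Metric Complex

namespace Literature.Probability.LatticeModels

variable {S : Finset (Site 2)} {δ : ℝ} {u v : Site 2} {w : ℂ}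

/-! ### Side midpoints of boundary edges -/

/-- The displacement between the mesh points of adjacent sites `p ∼ p'` of `ℤ²` is `±δ` or
`±δi`. [folklore] -/
theorem meshPoint_sub_meshPoint_of_adj (δ : ℝ) {p p' : Site 2} (h : (zdGraph 2).Adj p p') :
    ((meshPoint δ p' - meshPoint δ p).re = δ ∧ (meshPoint δ p' - meshPoint δ p).im = 0) ∨
    ((meshPoint δ p' - meshPoint δ p).re = -δ ∧ (meshPoint δ p' - meshPoint δ p).im = 0) ∨
    ((meshPoint δ p' - meshPoint δ p).re = 0 ∧ (meshPoint δ p' - meshPoint δ p).im = δ) ∨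
    ((meshPoint δ p' - meshPoint δ p).re = 0 ∧ (meshPoint δ p' - meshPoint δ p).im = -δ) := by
  simp only [sub_re, sub_im, meshPoint_re, meshPoint_im]
  rw [zdGraph_adj_iff, Fin.exists_fin_two] at h
  simp only [funext_iff, Fin.forall_fin_two, Pi.add_apply, Pi.single_eq_same,
    Pi.single_eq_of_ne (one_ne_zero : (1 : Fin 2) ≠ 0),
    Pi.single_eq_of_ne (zero_ne_one : (0 : Fin 2) ≠ 1), add_zero] at h
  rcases h with (⟨h0, h1⟩ | ⟨h0, h1⟩) | (⟨h0, h1⟩ | ⟨h0, h1⟩)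
  · refine Or.inl ⟨?_, ?_⟩ <;> [rw [h0]; rw [h1]] <;> push_cast <;> ring
  · refine Or.inr (Or.inl ⟨?_, ?_⟩) <;> [rw [h0]; rw [h1]] <;> push_cast <;> ring
  · refine Or.inr (Or.inr (Or.inl ⟨?_, ?_⟩)) <;> [rw [h0]; rw [h1]] <;> push_cast <;> ring
  · refine Or.inr (Or.inr (Or.inr ⟨?_, ?_⟩)) <;> [rw [h0]; rw [h1]] <;> push_cast <;> ring

/-- For adjacent sites `p ∼ p'` and `δ ≥ 0`, the displacement `δp' − δp` has coordinates of
absolute value `≤ δ` summing to `δ` in absolute value. [folklore] -/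
theorem abs_re_im_meshPoint_sub_of_adj (hδ : 0 ≤ δ) {p p' : Site 2} (h : (zdGraph 2).Adj p p') :
    |(meshPoint δ p' - meshPoint δ p).re| ≤ δ ∧ |(meshPoint δ p' - meshPoint δ p).im| ≤ δ ∧
      |(meshPoint δ p' - meshPoint δ p).re| + |(meshPoint δ p' - meshPoint δ p).im| = δ := by
  rcases meshPoint_sub_meshPoint_of_adj δ h with ⟨h0, h1⟩ | ⟨h0, h1⟩ | ⟨h0, h1⟩ | ⟨h0, h1⟩ <;>
    simp [h0, h1, abs_of_nonneg hδ, hδ]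

/-- A point of the cell of `v` at sup-distance `< δ/2` from the mesh point `δu` forces `u = v`
(`δ > 0`); with `w = δu` this is `eq_of_meshPoint_mem_cutCell`. [folklore] -/
theorem eq_of_mem_cutCell_of_abs_sub_lt (hδ : 0 < δ) (hw : w ∈ cutCell δ v)
    (hre : |w.re - (meshPoint δ u).re| < δ / 2) (him : |w.im - (meshPoint δ u).im| < δ / 2) :
    u = v := by
  obtain ⟨h1, h2, -⟩ := hw
  rw [meshPoint_re] at h1 hre
  rw [meshPoint_im] at h2 him
  have t0 := abs_sub_le (δ * (u 0 : ℝ)) w.re (δ * (v 0 : ℝ))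
  have t1 := abs_sub_le (δ * (u 1 : ℝ)) w.im (δ * (v 1 : ℝ))
  rw [abs_sub_comm (δ * (u 0 : ℝ)) w.re, ← mul_sub, abs_mul, abs_of_pos hδ] at t0
  rw [abs_sub_comm (δ * (u 1 : ℝ)) w.im, ← mul_sub, abs_mul, abs_of_pos hδ] at t1
  have k0 : |u 0 - v 0| < 1 := by
    have : |((u 0 - v 0 : ℤ) : ℝ)| < 1 := by
      push_cast
      exact lt_of_mul_lt_mul_left (by linarith) hδ.le
    exact_mod_cast this
  have k1 : |u 1 - v 1| < 1 := by
    have : |((u 1 - v 1 : ℤ) : ℝ)| < 1 := by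
      push_cast
      exact lt_of_mul_lt_mul_left (by linarith) hδ.le
    exact_mod_cast this
  rw [Int.abs_lt_one_iff, sub_eq_zero] at k0 k1
  exact funext (Fin.forall_fin_two.2 ⟨k0, k1⟩)

/-- **Side midpoints are boundary points.** For `δ > 0`, a site `p ∈ S` and an adjacent site
`p' ∉ S`, the midpoint `(δp + δp')/2` of the common side of their cells lies on the frontier of
`CellDomain S δ`: it is the endpoint of the open segment from `δp`, which lies in the domain, and
the points just beyond it towards `δp'` could only belong to the cell of `p' ∉ S`. These are the
marked points `a = (δp + δp')/2` of the route's Dobrushin cell domains. [folklore] -/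
theorem midpoint_mem_frontier_cellDomain (hδ : 0 < δ) {p p' : Site 2} (hp : p ∈ S)
    (hp' : p' ∉ S) (h : (zdGraph 2).Adj p p') :
    (meshPoint δ p + meshPoint δ p') / 2 ∈ frontier (CellDomain S δ) := by
  set m : ℂ := (meshPoint δ p + meshPoint δ p') / 2 with hm
  set d : ℂ := meshPoint δ p' - meshPoint δ p with hd
  obtain ⟨hre, him, hsum⟩ := abs_re_im_meshPoint_sub_of_adj hδ.le h
  have hm1 : m - meshPoint δ p = ((1 / 2 : ℝ) : ℂ) * d := by
    rw [hm, hd]; push_cast; ring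
  have hm2 : meshPoint δ p' - m = ((1 / 2 : ℝ) : ℂ) * d := by
    rw [hm, hd]; push_cast; ring
  rw [frontier, (isOpen_cellDomain S δ).interior_eq]
  constructor
  · -- `m ∈ closure Ω`: the open segment `(δp, m)` lies in `interior (cutCell δ p) ⊆ Ω`
    have hmcell : m ∈ cutCell δ p := by
      have e1 : m.re - (meshPoint δ p).re = 1 / 2 * d.re := by
        rw [← sub_re, hm1, re_ofReal_mul]
      have e2 : m.im - (meshPoint δ p).im = 1 / 2 * d.im := by
        rw [← sub_im, hm1, im_ofReal_mul]
      rw [mem_cutCell_iff, e1, e2, abs_mul, abs_mul, abs_of_pos (by norm_num : (0 : ℝ) < 1 / 2)]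
      exact ⟨by linarith, by linarith, by linarith⟩
    have hopen : openSegment ℝ (meshPoint δ p) m ⊆ CellDomain S δ :=
      ((convex_cutCell δ p).openSegment_interior_self_subset_interior
        (meshPoint_mem_interior_cutCell hδ p) hmcell).trans (interior_cutCell_subset_cellDomain hp δ)
    exact closure_mono hopen (segment_subset_closure_openSegment (right_mem_segment ℝ _ _))
  · -- `m ∉ Ω`: points just beyond `m` towards `δp'` would lie in the cell of `p' ∉ S`
    intro hmΩ
    obtain ⟨ε, hε, hball⟩ := Metric.isOpen_iff.1 (isOpen_cellDomain S δ) m hmΩ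
    set t : ℝ := min (1 / 2) (ε / δ) with ht
    have ht0 : 0 < t := lt_min (by norm_num) (div_pos hε hδ)
    have ht1 : t ≤ 1 / 2 := min_le_left _ _
    have htε : t * δ ≤ ε := by
      have : t ≤ ε / δ := min_le_right _ _
      rwa [le_div_iff₀ hδ] at this
    have hnorm : ‖d‖ ≤ δ := (norm_le_abs_re_add_abs_im d).trans hsum.le
    -- the point `w = m + t (δp' - m)`
    have hwΩ : m + (t : ℂ) * (meshPoint δ p' - m) ∈ CellDomain S δ := by
      refine hball ?_
      rw [mem_ball, dist_eq, add_sub_cancel_left, hm2, ← mul_assoc, ← ofReal_mul, norm_mul,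
        norm_real, Real.norm_eq_abs, abs_of_pos (by positivity)]
      calc t * (1 / 2) * ‖d‖ ≤ t * (1 / 2) * δ := by gcongr
        _ < ε := by nlinarith
    obtain ⟨v, hv, hwv⟩ := exists_mem_cutCell_of_mem_cellDomain hwΩ
    have hw : m + (t : ℂ) * (meshPoint δ p' - m) - meshPoint δ p' = ((-((1 - t) / 2) : ℝ) : ℂ) * d := by
      rw [hm, hd]; push_cast; ring
    have k : |-((1 - t) / 2)| * δ < δ / 2 := by
      rw [abs_neg, abs_of_pos (by linarith)]
      nlinarith
    have hpv : p' = v := by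
      refine eq_of_mem_cutCell_of_abs_sub_lt hδ hwv ?_ ?_
      · rw [← sub_re, hw, re_ofReal_mul, abs_mul]
        exact (mul_le_mul_of_nonneg_left hre (abs_nonneg _)).trans_lt k
      · rw [← sub_im, hw, im_ofReal_mul, abs_mul]
        exact (mul_le_mul_of_nonneg_left him (abs_nonneg _)).trans_lt k
    exact hp' (hpv ▸ hv)

end Literature.Probability.LatticeModels
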